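import Mathlib
import HarnessLib.Audit
import Summits.PneNP.PneNP.Theorems.PstarCrossRegime
import Summits.PneNP.PneNP.Theorems.PstarGateCaseT

/-!
# The blind free CROSS gate, regime T: after the basis change `toX m` the virtual chord reads the SECOND coordinate — the enlarged forcing set (node N3; O2 / E1; prover-1 g22)

FRONTIER range-avoidance ladder, rung F-N3 (`stmt-PneNP-19007`), cell `pnp-ideate`; restricted-model proof complexity — nothing here bears on `P` versus `NP`.

Node N3 (`PstarCrossNodes.CrossCaseT`): the real chords `E = (N.erase e_q).erase e_p` of the virtual system `V` read along ONE `m ∈ {(0,1), (1,1)}` and are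
read; the virtual chord `e_p` reads `(1,0)`.  This is E2's CASE T with the gate coefficient `ℓ ≡ 1` and the gated product replaced by `u_p ∨ u_q`: after
`PstarChordSystemMap.toX m` (`m ↦ (1,0)`, `(1,0) ↦ (0,1)`) the real chords read only the FIRST coordinate and the virtual chord only the SECOND, so the model
mirrors of `PstarGateCaseT` (`TransverseSnd`, `ReachSnd`, `reachSnd_iff`, `unreach_fst_of_reachSnd`, `forced_of_reachSnd`) apply verbatim:

* `transverseSnd_cross` — `TransverseSnd (mapSys V (toX m)) N₁ e_p a` at every base point;
* **`caseT_forced_cross`** — THE ENLARGED FORCING SET: for every `x` with `u_p(x) = u_q(x) = 0` OR `q_m(x) + (u_p ∨ u_q)(x) = 0` (`q_m = qDir I B m`),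
  every real chord `e' ∈ E` is ON: `u_{e'}(x) = 1` (the corner part is `PstarCrossRegime.corner_forces` again; the new part is
  `{u_p ∨ u_q = 1} ∩ Z(q_m + 1)`);
* **`caseT_fst_cross`** — on the same set the first basis-changed coordinate of "state-free part + reads of the chords that are ON" misses its target by one.
* **`forcing_of_real`** — the single-quadric form for a real chord `e' ∈ E`: **`Z(u_{e'}) ⊆ {u_p ∨ u_q = 1} ∩ Z(q_m)`**, to which
  `PstarRankRigidityFour.classification` / `PstarForcing.forcing_cases` apply (`Q_{D e'}` has rank `≥ 4`, `PstarChordBridgeForcing.rank_four_of_wf`).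
-/

set_option linter.dupNamespace false -- `Summit.PneNP.PneNP.…`: summit = sub-problem name (D-0017 single-conjunct layout)

open Finset Literature.Computability.Complexity
open Summit.PneNP.PneNP.Theorems.PstarFibrePolys (bit)
open Summit.PneNP.PneNP.Theorems.PstarTyped (Typed)
open Summit.PneNP.PneNP.Theorems.PstarSALevel (BoundaryExpanding SimpleOverlap)
open Summit.PneNP.PneNP.Theorems.PstarReadSumset (V2)
open Summit.PneNP.PneNP.Theorems.PstarChordSystem (ChordSystem)
open Summit.PneNP.PneNP.Theorems.PstarChordSystemMap (mapSys toX mapSys_u mapSys_ρ mapSys_ρ' mapSys_F mapSys_t toX_injective infeasible_mapSys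
  toX_zero)
open Summit.PneNP.PneNP.Theorems.PstarChordBridgeTools
open Summit.PneNP.PneNP.Theorems.PstarChordBridge
open Summit.PneNP.PneNP.Theorems.PstarChordBridgeBasis (qDir q_dir)
open Summit.PneNP.PneNP.Theorems.PstarGateRegime (fst_eq_of_unreach_fst)
open Summit.PneNP.PneNP.Theorems.PstarGateCaseT (TransverseSnd ReachSnd reachSnd_iff unreach_fst_of_reachSnd forced_of_reachSnd toX_self toX_gate)
open Summit.PneNP.PneNP.Theorems.PstarCrossData (CrossData)
open Summit.PneNP.PneNP.Theorems.PstarCrossSystem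

namespace Summit.PneNP.PneNP.Theorems.PstarCrossCaseT

variable {n m : ℕ}

section

variable (I : LocalMap 4 n m) {r : ℕ} {B : BridgeData n m} {e_p e_q g₀ : Fin m}

/-- **After `toX m` the virtual chord reads only the second coordinate, the real chords only the first.** -/
theorem transverseSnd_cross (hD : CrossData I r B e_p e_q g₀) {mv : V2} (hmvT : mv = (0, 1) ∨ mv = (1, 1))
    (hline : ∀ e ∈ (B.N.erase e_q).erase e_p,
      (((sys I B).vsys e_p e_q).ρ e 0 = 0 ∨ ((sys I B).vsys e_p e_q).ρ e 0 = mv) ∧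
      (((sys I B).vsys e_p e_q).ρ' e 0 = 0 ∨ ((sys I B).vsys e_p e_q).ρ' e 0 = mv))
    (a : Fin n → ZMod 2) : TransverseSnd (mapSys ((sys I B).vsys e_p e_q) (toX mv)) (B.N.erase e_q) e_p a := by
  have hmv : mv ≠ 0 := by rcases hmvT with rfl | rfl <;> decide
  have hconst := vsys_const I hD
  refine ⟨fun i hi hie => ?_, ?_, ?_⟩
  · rw [mapSys_ρ, mapSys_ρ', (hconst i a 0).1, (hconst i a 0).2]
    obtain ⟨h1, h2⟩ := hline i (mem_erase.2 ⟨hie, hi⟩)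
    refine ⟨?_, ?_⟩
    · rcases h1 with h | h
      · rw [h, map_zero]; rfl
      · rw [h, toX_self hmv]
    · rcases h2 with h | h
      · rw [h, map_zero]; rfl
      · rw [h, toX_self hmv]
  · rw [mapSys_ρ', (vsys_reads_p I hD a).2, map_zero]
  · rw [mapSys_ρ, (vsys_reads_p I hD a).1, toX_gate hmvT]

/-- The virtual chord's second-coordinate read after `toX m` is `1`. -/
theorem toX_cross_read (hD : CrossData I r B e_p e_q g₀) {mv : V2} (hmvT : mv = (0, 1) ∨ mv = (1, 1)) (a : Fin n → ZMod 2) :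
    ((mapSys ((sys I B).vsys e_p e_q) (toX mv)).ρ e_p a).2 = 1 := by
  rw [mapSys_ρ, (vsys_reads_p I hD a).1, toX_gate hmvT]

/-- The basis-changed "second constraint" of the virtual system is `q_m`. -/
theorem q_dir_cross (B : BridgeData n m) (e_p e_q : Fin m) (mv : V2) (x : Fin n → ZMod 2) :
    ((mapSys ((sys I B).vsys e_p e_q) (toX mv)).F x).2 + (mapSys ((sys I B).vsys e_p e_q) (toX mv)).t.2 = qDir I B mv x :=
  q_dir I B mv x

/-- Reachability of the second coordinate in regime T: the corner, or `q_m + (u_p ∨ u_q) = 0`. -/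
theorem reachSnd_cross (hD : CrossData I r B e_p e_q g₀) {mv : V2} (hmvT : mv = (0, 1) ∨ mv = (1, 1))
    (hline : ∀ e ∈ (B.N.erase e_q).erase e_p,
      (((sys I B).vsys e_p e_q).ρ e 0 = 0 ∨ ((sys I B).vsys e_p e_q).ρ e 0 = mv) ∧
      (((sys I B).vsys e_p e_q).ρ' e 0 = 0 ∨ ((sys I B).vsys e_p e_q).ρ' e 0 = mv))
    {x : Fin n → ZMod 2} (hx : (sys I B).orU e_p e_q x = 0 ∨ qDir I B mv x + (sys I B).orU e_p e_q x = 0) :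
    ReachSnd (mapSys ((sys I B).vsys e_p e_q) (toX mv)) (B.N.erase e_q) x := by
  have hpe : e_p ∈ B.N.erase e_q := mem_erase.2 ⟨hD.ne, hD.mem_p⟩
  rw [reachSnd_iff _ hpe (transverseSnd_cross I hD hmvT hline x), toX_cross_read I hD hmvT, mapSys_u, ChordSystem.vsys_u_self]
  rcases hx with h | h
  · exact Or.inl ⟨h, rfl⟩
  · right
    have hq := q_dir_cross I B e_p e_q mv x
    have e3 : ∀ F t q u : ZMod 2, F + t = q → q + u = 0 → F + u * 1 = t := by decide
    exact e3 _ _ _ _ hq h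

/-- **Regime T: THE ENLARGED FORCING SET.**  On `{u_p = u_q = 0} ∪ {q_m + (u_p ∨ u_q) = 0}` every real chord of the virtual system is ON. -/
theorem caseT_forced_cross (hI : I.IsPure xorAndPred) (hT : Typed I) (hD : CrossData I r B e_p e_q g₀) {mv : V2} (hmvT : mv = (0, 1) ∨ mv = (1, 1))
    (hline : ∀ e ∈ (B.N.erase e_q).erase e_p,
      (((sys I B).vsys e_p e_q).ρ e 0 = 0 ∨ ((sys I B).vsys e_p e_q).ρ e 0 = mv) ∧
      (((sys I B).vsys e_p e_q).ρ' e 0 = 0 ∨ ((sys I B).vsys e_p e_q).ρ' e 0 = mv))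
    (hread : ∀ e ∈ (B.N.erase e_q).erase e_p, ((sys I B).vsys e_p e_q).ρ e 0 ≠ 0 ∨ ((sys I B).vsys e_p e_q).ρ' e 0 ≠ 0)
    {x : Fin n → ZMod 2} (hx : (sys I B).orU e_p e_q x = 0 ∨ qDir I B mv x + (sys I B).orU e_p e_q x = 0) :
    ∀ e' ∈ (B.N.erase e_q).erase e_p, (sys I B).u e' x = 1 := by
  intro e' he'
  have hmv : mv ≠ 0 := by rcases hmvT with rfl | rfl <;> decide
  set V := (sys I B).vsys e_p e_q with hV
  set S' := mapSys V (toX mv) with hS'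
  have hinf' : S'.Infeasible (B.N.erase e_q) := infeasible_mapSys _ (toX_injective hmv) (vsys_infeasible I hI hT hD)
  have hTr : TransverseSnd S' (B.N.erase e_q) e_p x := transverseSnd_cross I hD hmvT hline x
  have hreach : ReachSnd S' (B.N.erase e_q) x := reachSnd_cross I hD hmvT hline hx
  have hconst := vsys_const I hD
  have hR' : S'.Read e' x := by
    unfold ChordSystem.Read
    rw [hS', mapSys_ρ, mapSys_ρ', hV, (hconst e' x 0).1, (hconst e' x 0).2]
    rcases hread e' he' with h | h
    · exact Or.inl fun h0 => h (toX_injective hmv (by rw [h0, map_zero]))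
    · exact Or.inr fun h0 => h (toX_injective hmv (by rw [h0, map_zero]))
  have hu := forced_of_reachSnd S' hinf' hTr hreach (mem_of_mem_erase he') (ne_of_mem_erase he') hR'
  rw [hS', mapSys_u, hV, ChordSystem.vsys_u_of_ne _ _ _ (ne_of_mem_erase he')] at hu
  exact hu

/-- **Regime T, single-quadric form for a real chord**: `Z(u_{e'}) ⊆ {u_p ∨ u_q = 1} ∩ Z(q_m)` — a point where `e'` is OFF lies outside the forcing
set, i.e. off the corner and with `q_m + 1 ≠ 0`. -/
theorem forcing_of_real (hI : I.IsPure xorAndPred) (hT : Typed I) (hD : CrossData I r B e_p e_q g₀) {mv : V2} (hmvT : mv = (0, 1) ∨ mv = (1, 1))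
    (hline : ∀ e ∈ (B.N.erase e_q).erase e_p,
      (((sys I B).vsys e_p e_q).ρ e 0 = 0 ∨ ((sys I B).vsys e_p e_q).ρ e 0 = mv) ∧
      (((sys I B).vsys e_p e_q).ρ' e 0 = 0 ∨ ((sys I B).vsys e_p e_q).ρ' e 0 = mv))
    (hread : ∀ e ∈ (B.N.erase e_q).erase e_p, ((sys I B).vsys e_p e_q).ρ e 0 ≠ 0 ∨ ((sys I B).vsys e_p e_q).ρ' e 0 ≠ 0)
    {e' : Fin m} (he' : e' ∈ (B.N.erase e_q).erase e_p) {x : Fin n → ZMod 2} (hx : (sys I B).u e' x = 0) :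
    (sys I B).orU e_p e_q x = 1 ∧ qDir I B mv x = 0 := by
  have key : ∀ o q : ZMod 2, ¬ (o = 0 ∨ q + o = 0) → o = 1 ∧ q = 0 := by decide
  refine key _ _ fun h => ?_
  have h1 := caseT_forced_cross I hI hT hD hmvT hline hread h e' he'
  rw [hx] at h1
  exact zero_ne_one h1

/-- **Regime T, the first basis-changed coordinate** on the forcing set: state-free part plus the reads of the ON chords misses its target by one. -/
theorem caseT_fst_cross (hI : I.IsPure xorAndPred) (hT : Typed I) (hD : CrossData I r B e_p e_q g₀) {mv : V2} (hmvT : mv = (0, 1) ∨ mv = (1, 1))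
    (hline : ∀ e ∈ (B.N.erase e_q).erase e_p,
      (((sys I B).vsys e_p e_q).ρ e 0 = 0 ∨ ((sys I B).vsys e_p e_q).ρ e 0 = mv) ∧
      (((sys I B).vsys e_p e_q).ρ' e 0 = 0 ∨ ((sys I B).vsys e_p e_q).ρ' e 0 = mv))
    {x : Fin n → ZMod 2} (hx : (sys I B).orU e_p e_q x = 0 ∨ qDir I B mv x + (sys I B).orU e_p e_q x = 0) :
    ((mapSys ((sys I B).vsys e_p e_q) (toX mv)).F x).1 +
        ∑ i ∈ (B.N.erase e_q).filter (fun i => ¬ ((sys I B).vsys e_p e_q).u i x = 0),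
          ((mapSys ((sys I B).vsys e_p e_q) (toX mv)).ρ i x + (mapSys ((sys I B).vsys e_p e_q) (toX mv)).ρ' i x).1 =
      (mapSys ((sys I B).vsys e_p e_q) (toX mv)).t.1 + 1 := by
  have hmv : mv ≠ 0 := by rcases hmvT with rfl | rfl <;> decide
  have hpe : e_p ∈ B.N.erase e_q := mem_erase.2 ⟨hD.ne, hD.mem_p⟩
  set S' := mapSys ((sys I B).vsys e_p e_q) (toX mv) with hS'
  have hinf' : S'.Infeasible (B.N.erase e_q) := infeasible_mapSys _ (toX_injective hmv) (vsys_infeasible I hI hT hD)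
  have hTr : TransverseSnd S' (B.N.erase e_q) e_p x := transverseSnd_cross I hD hmvT hline x
  have hreach : ReachSnd S' (B.N.erase e_q) x := reachSnd_cross I hD hmvT hline hx
  have h := fst_eq_of_unreach_fst S' (unreach_fst_of_reachSnd S' hinf' hpe hTr hreach)
  rw [hS', mapSys_u] at h
  exact h

end

end Summit.PneNP.PneNP.Theorems.PstarCrossCaseT
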